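import Summits.Ventures.Crystal3D.Theorems.StickyWulffConstantPolycrystalWulffBoundRungSingleAxis
import Summits.Ventures.Crystal3D.Theorems.StickyWulffConstantPolycrystalWulffBoundInclinedLamellarSections
import Summits.Ventures.Crystal3D.Theorems.StickyWulffConstantPolycrystalWulffBoundMergingCalculus
import Summits.Ventures.Crystal3D.Theorems.StickyWulffConstantTextureLiminfPolytopeCalculus

/-!
# `PolycrystalWulffBound`, line `PolyDensity`: the general single-axis rung IN THE CRUX'S OWN ENERGY —
# `6·2^{1/3}(√2·Vol)^{2/3} ≤ En` for single-axis twin textures of ARBITRARY polyhedral geometry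
# passing the aggregate azimuth test (crux `stmt-Ventures-19482`)

Route `StickyWulffConstant` of the venture `Summits/Ventures/Crystal3D`, second prover lane (poly-p2,
gen 10).  Texture form of `rung_singleAxis_cells` (`…RungSingleAxis`): a crux texture `Tex n G A c m`
(law `(1, ½)`) presented by a cell family (pairwise disjoint bounded open polytopes with antisymmetric
separating unit normals `ν_{ab}`; grain `f` = union of the cells `s f`; every cell used), all frames
co-axial about `m₀` (`Ax m₀`), a Bool labelling `τ` of the grains that IS the lattice class
(`τ f = τ g ↔ A_f Λ₀ = A_g Λ₀`), wall data recording the axis (`m f g = m₀` across the two classes),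
`u` a horizontal nearest-neighbour bond and mirror normal of every lattice, `w ⊥ m₀, u` the unit
`⟨112⟩` vector, and the AGGREGATE AZIMUTH CONDITION
`(2/√6)·Σ_{τ f ≠ τ g} Σ_{a ∈ s f, b ∈ s g} |⟪w, ν_{ab}⟫|·facetArea ≤ ½·Σ_{τ f ≠ τ g} Σ_{a,b} sin∠(ν_{ab}, m₀)·facetArea`
(true wall by wall when the twin walls' horizontal normals stay ≥ 52.2° away from `w`; always true for
one of the three `w` unless the twin-wall area is balanced over the three `⟨112⟩` azimuth classes):
then `6·2^{1/3}(√2·Vol)^{2/3} ≤ En n G A c m` (`rung_singleAxis_texture`).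
Chain: cell rung (cells inherit frames and labels from their grains); `Fr(cells) = Fr(grains)`
(`freeEnergy_eq_merged_texture`, merging the cells of each grain); the cell wall sum regrouped by
grains; `ι_{Dsc m₀}(G_f, G_g) ≥ Σ_{a,b} sin∠(ν_{ab}, m₀)·facetArea` (`sinSum_le_iota_of_polytopeCalculus`,
facet calculus clause (B) + `sin ≤ h_{Dsc}`); `c ≥ ½` on twin walls (`Tex`).
WHAT THIS IS NOT: textures failing the azimuth test (e.g. the `W_min` centre cones), multi-axis
colonies; the crux is not claimed.
-/

noncomputable section

open scoped BigOperators InnerProductSpace ENNReal Pointwise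
open MeasureTheory Filter Set

namespace Summit.Ventures.Crystal3D.Cruxes.PolycrystalWulffBound.PolyDensity

open Summit.Ventures.Crystal3D.Theorems
open Summit.Ventures.Crystal3D.Cruxes.TextureLiminf.TexShadow (per polytope facetArea supportFn E3
  PolytopeCalculus stub_polytopeCalculus)
open Literature.MathematicalPhysics.StatisticalMechanics (fccStacking barlowStacking IsHaggSeq perimeter)

/-- **Twin-wall interface measure dominates the `sin∠`-weighted facet areas** (general normals): for
two disjoint families of cells of one complex with antisymmetric separating normals,
`Σ_{a ∈ sA, b ∈ sB} √(1 − ⟪ν_{ab}, m⟫²)·facetArea(Q̄_a ∩ Q̄_b) ≤ ι_{Dsc m}(⋃ sA, ⋃ sB)`. -/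
theorem sinSum_le_iota_of_polytopeCalculus (hPC : PolytopeCalculus) {m : E3} (hm : ‖m‖ = 1)
    {k : ℕ} (H : Fin k → Finset (E3 × ℝ)) (nv : Fin k → Fin k → E3)
    (hbd : ∀ j, Bornology.IsBounded (polytope (H j)))
    (hdisj : ∀ j j', j ≠ j' → Disjoint (polytope (H j)) (polytope (H j')))
    (hanti : ∀ i j, nv j i = -nv i j)
    (hplane : ∀ j j', j ≠ j' → ‖nv j j'‖ = 1 ∧ ∃ b : ℝ,
      closure (polytope (H j)) ∩ closure (polytope (H j')) ⊆ {x | ⟪nv j j', x⟫_ℝ = b})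
    {sA sB : Finset (Fin k)} (hAB : Disjoint sA sB) :
    ∑ a ∈ sA, ∑ b ∈ sB, Real.sqrt (1 - ⟪nv a b, m⟫_ℝ ^ 2) *
        facetArea (closure (polytope (H a)) ∩ closure (polytope (H b))) (nv a b) ≤
      (per {y : E3 | ‖y‖ ≤ 1 ∧ ⟪y, m⟫_ℝ = 0} (⋃ j ∈ sA, polytope (H j)) +
        per {y : E3 | ‖y‖ ≤ 1 ∧ ⟪y, m⟫_ℝ = 0} (⋃ j ∈ sB, polytope (H j)) -
        per {y : E3 | ‖y‖ ≤ 1 ∧ ⟪y, m⟫_ℝ = 0} (⋃ j ∈ sA ∪ sB, polytope (H j))) / 2 := by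
  set K : Set E3 := {y : E3 | ‖y‖ ≤ 1 ∧ ⟪y, m⟫_ℝ = 0} with hK
  have hKc : IsCompact K :=
    Metric.isCompact_of_isClosed_isBounded
      ((isClosed_le continuous_norm continuous_const).inter
        (isClosed_eq (continuous_id.inner continuous_const) continuous_const))
      (Metric.isBounded_closedBall.subset (cruxDisc_subset_closedBall m))
  rw [per_add_per_sub_per_union_eq_crossSum_of_polytopeCalculus hPC hKc (convex_cruxDisc m)
    (zero_mem_cruxDisc m) H nv hbd hdisj hplane hAB, le_div_iff₀ (by norm_num : (0:ℝ) < 2),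
    Finset.sum_mul]
  refine Finset.sum_le_sum fun a ha => ?_
  rw [Finset.sum_mul]
  refine Finset.sum_le_sum fun b hb => ?_
  have hab : a ≠ b := fun h => Finset.disjoint_left.1 hAB ha (h ▸ hb)
  have hν : ‖nv a b‖ = 1 := (hplane a b hab).1
  -- the kernel is symmetric: the `else` branch equals the `then` branch
  have hsymm : (supportFn K (nv b a) + supportFn K (-nv b a)) *
      facetArea (closure (polytope (H b)) ∩ closure (polytope (H a))) (nv b a) =
      (supportFn K (nv a b) + supportFn K (-nv a b)) *
      facetArea (closure (polytope (H a)) ∩ closure (polytope (H b))) (nv a b) := by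
    rw [hanti a b, neg_neg, Set.inter_comm, facetArea_neg, add_comm]
  have hval : (if a < b then (supportFn K (nv a b) + supportFn K (-nv a b)) *
        facetArea (closure (polytope (H a)) ∩ closure (polytope (H b))) (nv a b)
      else (supportFn K (nv b a) + supportFn K (-nv b a)) *
        facetArea (closure (polytope (H b)) ∩ closure (polytope (H a))) (nv b a)) =
      (supportFn K (nv a b) + supportFn K (-nv a b)) *
        facetArea (closure (polytope (H a)) ∩ closure (polytope (H b))) (nv a b) := by
    split_ifs
    · rfl
    · exact hsymm
  rw [hval]
  have hs1 : Real.sqrt (1 - ⟪nv a b, m⟫_ℝ ^ 2) ≤ supportFn K (nv a b) :=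
    sin_le_supportFn_cruxDisc hm hν
  have hs2 : Real.sqrt (1 - ⟪nv a b, m⟫_ℝ ^ 2) ≤ supportFn K (-nv a b) := by
    have h := sin_le_supportFn_cruxDisc (ν := -nv a b) hm (by rw [norm_neg, hν])
    rwa [inner_neg_left, neg_sq] at h
  have hfa : 0 ≤ facetArea (closure (polytope (H a)) ∩ closure (polytope (H b))) (nv a b) :=
    ENNReal.toReal_nonneg
  nlinarith [hs1, hs2, hfa]

/-- **Rung `rung_singleAxis_texture`**: single-axis twin textures of arbitrary polyhedral geometry
passing the aggregate azimuth test satisfy `6·2^{1/3}(√2·Vol)^{2/3} ≤ En`. -/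
theorem rung_singleAxis_texture :
    let Λ : Set (EuclideanSpace ℝ (Fin 3)) := Literature.MathematicalPhysics.StatisticalMechanics.fccStacking 1 (Real.sqrt (2 / 3));
    let Brl : (ℤ → ℤ) → Set (EuclideanSpace ℝ (Fin 3)) := Literature.MathematicalPhysics.StatisticalMechanics.barlowStacking 1 (Real.sqrt (2 / 3));
    let Ax : EuclideanSpace ℝ (Fin 3) → (EuclideanSpace ℝ (Fin 3) ≃ₗᵢ[ℝ] EuclideanSpace ℝ (Fin 3)) → (EuclideanSpace ℝ (Fin 3) ≃ₗᵢ[ℝ] EuclideanSpace ℝ (Fin 3)) → Prop := fun m A B => ∃ (L : EuclideanSpace ℝ (Fin 3) ≃ₗᵢ[ℝ] EuclideanSpace ℝ (Fin 3)) (s₁ s₂ : EuclideanSpace ℝ (Fin 3)) (σ σ' : ℤ → ℤ), Literature.MathematicalPhysics.StatisticalMechanics.IsHaggSeq σ ∧ Literature.MathematicalPhysics.StatisticalMechanics.IsHaggSeq σ' ∧ L (EuclideanSpace.single (2 : Fin 3) (1 : ℝ)) = m ∧ A '' Λ ⊆ (fun q => L q + s₁) '' Brl σ ∧ B '' Λ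 ⊆ (fun q => L q + s₂) '' Brl σ';
    let CoAx : (EuclideanSpace ℝ (Fin 3) ≃ₗᵢ[ℝ] EuclideanSpace ℝ (Fin 3)) → (EuclideanSpace ℝ (Fin 3) ≃ₗᵢ[ℝ] EuclideanSpace ℝ (Fin 3)) → Prop := fun A B => ∃ m, Ax m A B;
    let Φ : EuclideanSpace ℝ (Fin 3) → ℝ := fun ν => Real.sqrt 2 / 4 * ∑ᶠ w ∈ {w ∈ Λ | ‖w‖ = 1}, |⟪w, ν⟫_ℝ|;
    let Per : Set (EuclideanSpace ℝ (Fin 3)) → Set (EuclideanSpace ℝ (Fin 3)) → ℝ := fun K S => (⨆ (ξ : EuclideanSpace ℝ (Fin 3) → EuclideanSpace ℝ (Fin 3)) (_ : ContDiff ℝ 1 ξ ∧ HasCompactSupport ξ ∧ ∀ z, ξ z ∈ K), ENNReal.ofReal (∫ z in S, Literature.MathematicalPhysics.StatisticalMechanics.fieldDivergence ξ z)).toReal;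
    let ι : Set (EuclideanSpace ℝ (Fin 3)) → Set (EuclideanSpace ℝ (Fin 3)) → Set (EuclideanSpace ℝ (Fin 3)) → ℝ := fun K S₁ S₂ => (Per K S₁ + Per K S₂ - Per K (S₁ ∪ S₂)) / 2;
    let W : (EuclideanSpace ℝ (Fin 3) ≃ₗᵢ[ℝ] EuclideanSpace ℝ (Fin 3)) → Set (EuclideanSpace ℝ (Fin 3)) := fun A => {y | ∀ ν : EuclideanSpace ℝ (Fin 3), ⟪y, ν⟫_ℝ ≤ Φ (A.symm ν)};
    let Dsc : EuclideanSpace ℝ (Fin 3) → Set (EuclideanSpace ℝ (Fin 3)) := fun m => {y | ‖y‖ ≤ 1 ∧ ⟪y, m⟫_ℝ = 0};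
    let Tex : (n : ℕ) → (Fin n → Set (EuclideanSpace ℝ (Fin 3))) → (Fin n → (EuclideanSpace ℝ (Fin 3) ≃ₗᵢ[ℝ] EuclideanSpace ℝ (Fin 3))) → (Fin n → Fin n → ℝ) → (Fin n → Fin n → EuclideanSpace ℝ (Fin 3)) → Prop := fun n G A c m => (∀ f : Fin n, Literature.MathematicalPhysics.StatisticalMechanics.HasFinitePerimeter (G f) ∧ volume (G f) < ⊤) ∧ (∀ f g, f ≠ g → Disjoint (G f) (G g)) ∧ (∀ f g, f ≠ g → 0 ≤ c f g) ∧ (∀ f g, f ≠ g → ¬ CoAx (A f) (A g) → m f g = 0 ∧ 1 ≤ c f g) ∧ (∀ f g, f ≠ g → CoAx (A f) (A g) → A f '' Λ ≠ A g '' Λ → Ax (m f g) (A f) (A g) ∧ 1 / 2 ≤ c f g);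
    let En : (n : ℕ) → (Fin n → Set (EuclideanSpace ℝ (Fin 3))) → (Fin n → (EuclideanSpace ℝ (Fin 3) ≃ₗᵢ[ℝ] EuclideanSpace ℝ (Fin 3))) → (Fin n → Fin n → ℝ) → (Fin n → Fin n → EuclideanSpace ℝ (Fin 3)) → ℝ := fun n G A c m => ∑ f : Fin n, Per (W (A f)) (G f) - ∑ f, ∑ g, (if f = g then 0 else ι (W (A f)) (G f) (G g)) + ∑ f, ∑ g, (if f = g then 0 else c f g / 2 * ι (Dsc (m f g)) (G f) (G g));
    let Vol : (n : ℕ) → (Fin n → Set (EuclideanSpace ℝ (Fin 3))) → ℝ := fun n G => (volume (⋃ f : Fin n, G f)).toReal;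
    ∀ (k' : ℕ) (Hc : Fin k' → Finset ((EuclideanSpace ℝ (Fin 3)) × ℝ)) (nv : Fin k' → Fin k' → EuclideanSpace ℝ (Fin 3)),
      (∀ j, Bornology.IsBounded (polytope (Hc j))) →
      (∀ j j', j ≠ j' → Disjoint (polytope (Hc j)) (polytope (Hc j'))) →
      (∀ i j, nv j i = -nv i j) →
      (∀ j j', j ≠ j' → ‖nv j j'‖ = 1 ∧ ∃ b : ℝ,
        closure (polytope (Hc j)) ∩ closure (polytope (Hc j')) ⊆ {x | ⟪nv j j', x⟫_ℝ = b}) →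
    ∀ (n : ℕ) (G : Fin n → Set (EuclideanSpace ℝ (Fin 3)))
      (A : Fin n → (EuclideanSpace ℝ (Fin 3) ≃ₗᵢ[ℝ] EuclideanSpace ℝ (Fin 3)))
      (c : Fin n → Fin n → ℝ) (m : Fin n → Fin n → EuclideanSpace ℝ (Fin 3)),
      Tex n G A c m →
    ∀ (s : Fin n → Finset (Fin k')),
      (∀ f, G f = ⋃ j ∈ s f, polytope (Hc j)) →
      (∀ f g, f ≠ g → Disjoint (s f) (s g)) →
      (∀ j, ∃ f, j ∈ s f) →
    ∀ (τ : Fin n → Bool), (∀ f g, τ f = τ g → A f '' Λ = A g '' Λ) → (∀ f g, τ f ≠ τ g → A f '' Λ ≠ A g '' Λ) →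
    ∀ (m₀ u w : EuclideanSpace ℝ (Fin 3)), (∀ f g, Ax m₀ (A f) (A g)) → (∀ f g, f ≠ g → τ f ≠ τ g → m f g = m₀) →
      ‖u‖ = 1 → ‖w‖ = 1 → ⟪u, m₀⟫_ℝ = 0 → ⟪w, m₀⟫_ℝ = 0 → ⟪w, u⟫_ℝ = 0 →
      (∀ f, u ∈ A f '' Λ) → (∀ f, (ℝ ∙ u)ᗮ.reflection '' (A f '' Λ) = A f '' Λ) →
      2 / Real.sqrt 6 * ∑ f, ∑ g, (if τ f = τ g then 0 else ∑ a ∈ s f, ∑ b ∈ s g,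
          |⟪w, nv a b⟫_ℝ| * facetArea (closure (polytope (Hc a)) ∩ closure (polytope (Hc b))) (nv a b)) ≤
        1 / 2 * ∑ f, ∑ g, (if τ f = τ g then 0 else ∑ a ∈ s f, ∑ b ∈ s g,
          Real.sqrt (1 - ⟪nv a b, m₀⟫_ℝ ^ 2) * facetArea (closure (polytope (Hc a)) ∩ closure (polytope (Hc b))) (nv a b)) →
    6 * (2 : ℝ) ^ ((1 : ℝ) / 3) * (Real.sqrt 2 * Vol n G) ^ ((2 : ℝ) / 3) ≤ En n G A c m := by
  intro Λ Brl Ax CoAx Φ Per ι W Dsc Tex En Vol k' Hc nv hbd hdisjQ hanti hplane n G A c m hTex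
    s hGs hsdisj hcov τ hτ1 hτ2 m₀ u w hAx hmax hu hw hum hwm hwu hbond hmir hAz
  classical
  obtain ⟨hfin, hdisjG, hc0, -, htwin⟩ := hTex
  have hvol : ∀ f, volume (G f) < ⊤ := fun f => (hfin f).2
  have hPC := stub_polytopeCalculus
  rcases Nat.eq_zero_or_pos n with hn | hn
  · subst hn
    show 6 * (2 : ℝ) ^ ((1 : ℝ) / 3) * (Real.sqrt 2 * (volume (⋃ f : Fin 0, G f)).toReal) ^ ((2 : ℝ) / 3) ≤
      ∑ f : Fin 0, Per (W (A f)) (G f) - ∑ f : Fin 0, ∑ g, (if f = g then 0 else ι (W (A f)) (G f) (G g)) +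
        ∑ f : Fin 0, ∑ g, (if f = g then 0 else c f g / 2 * ι (Dsc (m f g)) (G f) (G g))
    rw [iUnion_of_empty, measure_empty, ENNReal.toReal_zero, mul_zero, Real.zero_rpow (by norm_num),
      mul_zero]
    simp
  have hm₀ : ‖m₀‖ = 1 := by
    obtain ⟨L, -, -, -, -, -, -, hLm, -, -⟩ := hAx ⟨0, hn⟩ ⟨0, hn⟩
    rw [← hLm, LinearIsometryEquiv.norm_map, PiLp.norm_single, norm_one]
  -- cells, their grains
  set Q : Fin k' → Set E3 := fun j => polytope (Hc j) with hQ
  choose gr hgr using hcov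
  have hgr_eq : ∀ j f, j ∈ s f → gr j = f := by
    intro j f hj
    by_contra h
    exact Finset.disjoint_left.1 (hsdisj _ _ h) (hgr j) hj
  have hfilter : ∀ f, Finset.univ.filter (fun j => gr j = f) = s f := by
    intro f; ext j
    simp only [Finset.mem_filter, Finset.mem_univ, true_and]
    exact ⟨fun h => h ▸ hgr j, fun h => hgr_eq j f h⟩
  have hQpoly : ∀ j, ∃ (k : ℕ) (H' : Fin k → Finset (E3 × ℝ)), Q j = ⋃ i, polytope (H' i) :=
    fun j => ⟨1, fun _ => Hc j, by ext x; simp [hQ]⟩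
  have hQvol : ∀ j, volume (Q j) < ⊤ := fun j => (hbd j).measure_lt_top
  -- the cell rung
  set fa : Fin k' → Fin k' → ℝ := fun a b =>
    facetArea (closure (polytope (Hc a)) ∩ closure (polytope (Hc b))) (nv a b) with hfa
  have hfa0 : ∀ a b, 0 ≤ fa a b := fun a b => ENNReal.toReal_nonneg
  have hR := rung_singleAxis_cells k' Hc (fun j => A (gr j)) nv (fun j => τ (gr j)) m₀ u w hbd hdisjQ
    hanti hplane (fun j j' => hAx (gr j) (gr j'))
    (fun j j' h => wulffBody_eq_of_image_eq (hτ1 _ _ h)) hu hw hum hwm hwu (fun j => hbond (gr j))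
    (fun j => hmir (gr j))
  -- (i) volumes agree
  have hUnion : (⋃ j, ⋂ p ∈ Hc j, {x : E3 | ⟪p.1, x⟫_ℝ < p.2}) = ⋃ f, G f := by
    apply subset_antisymm
    · intro x hx
      obtain ⟨j, hj⟩ := mem_iUnion.1 hx
      refine mem_iUnion.2 ⟨gr j, ?_⟩
      rw [hGs]
      exact mem_biUnion (hgr j) hj
    · intro x hx
      obtain ⟨f, hf⟩ := mem_iUnion.1 hx
      rw [hGs] at hf
      obtain ⟨j, -, hj⟩ := mem_iUnion₂.1 hf
      exact mem_iUnion.2 ⟨j, hj⟩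
  -- (ii) free energies agree: merge the cells of each grain
  have hWc : ∀ f, IsCompact (W (A f)) := fun f => isCompact_cruxWulffBody (A f)
  have hWv : ∀ f, Convex ℝ (W (A f)) := fun f => convex_cruxWulffBody (A f)
  have hW0 : ∀ f, (0 : E3) ∈ W (A f) := fun f => zero_mem_cruxWulffBody (A f)
  have hWs : ∀ f, -W (A f) = W (A f) := fun f => neg_cruxWulffBody_eq (A f)
  have hmerge := freeEnergy_eq_merged_texture Q hQpoly hQvol hdisjQ gr Finset.univ
    (fun j => Finset.mem_univ _) (fun f => W (A f)) hWc hWv hW0 hWs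
  have hUf : ∀ f, (⋃ j ∈ Finset.univ.filter (fun j => gr j = f), Q j) = G f := by
    intro f; rw [hfilter, hGs]
  simp only [hUf] at hmerge
  have hFr : (∑ j, Per (W (A (gr j))) (⋂ p ∈ Hc j, {x : E3 | ⟪p.1, x⟫_ℝ < p.2}) -
      ∑ j, ∑ j', (if j = j' then 0 else ι (W (A (gr j))) (⋂ p ∈ Hc j, {x : E3 | ⟪p.1, x⟫_ℝ < p.2})
        (⋂ p ∈ Hc j', {x : E3 | ⟪p.1, x⟫_ℝ < p.2}))) =
      ∑ f, Per (W (A f)) (G f) - ∑ f, ∑ g, (if f = g then 0 else ι (W (A f)) (G f) (G g)) := by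
    rw [← Finset.sum_sub_distrib, ← Finset.sum_sub_distrib]
    exact hmerge
  -- (iii) the cell wall sum regrouped by grains
  set t : Fin k' → Fin k' → ℝ := fun a b => |⟪w, nv a b⟫_ℝ| * fa a b with ht
  have hregroup : (∑ j, ∑ j', (if τ (gr j) = τ (gr j') then 0 else t j j')) =
      ∑ f, ∑ g, (if τ f = τ g then 0 else ∑ a ∈ s f, ∑ b ∈ s g, t a b) := by
    have hmaps : ∀ j ∈ (Finset.univ : Finset (Fin k')), gr j ∈ (Finset.univ : Finset (Fin n)) :=
      fun j _ => Finset.mem_univ _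
    rw [← Finset.sum_fiberwise_of_maps_to hmaps]
    refine Finset.sum_congr rfl fun f _ => ?_
    rw [hfilter]
    have hinner : ∀ a ∈ s f, (∑ j', (if τ (gr a) = τ (gr j') then 0 else t a j')) =
        ∑ g, (if τ f = τ g then 0 else ∑ b ∈ s g, t a b) := by
      intro a ha
      rw [hgr_eq a f ha, ← Finset.sum_fiberwise_of_maps_to hmaps]
      refine Finset.sum_congr rfl fun g _ => ?_
      rw [hfilter]
      by_cases hfg : τ f = τ g
      · rw [if_pos hfg]
        refine Finset.sum_eq_zero fun b hb => ?_
        rw [hgr_eq b g hb, if_pos hfg]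
      · rw [if_neg hfg]
        refine Finset.sum_congr rfl fun b hb => ?_
        rw [hgr_eq b g hb, if_neg hfg]
    rw [Finset.sum_congr rfl hinner, Finset.sum_comm]
    refine Finset.sum_congr rfl fun g _ => ?_
    by_cases hfg : τ f = τ g
    · simp only [if_pos hfg, Finset.sum_const_zero]
    · simp only [if_neg hfg]
  -- (iv) the walls of the texture pay for the cell wall sum
  set Z : ℝ := ∑ f, ∑ g, (if τ f = τ g then 0 else ∑ a ∈ s f, ∑ b ∈ s g,
    Real.sqrt (1 - ⟪nv a b, m₀⟫_ℝ ^ 2) * fa a b) with hZ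
  have hwall : (1 : ℝ) / 4 * Z ≤ ∑ f, ∑ g, (if f = g then 0 else c f g / 2 * ι (Dsc (m f g)) (G f) (G g)) := by
    rw [hZ, Finset.mul_sum]
    refine Finset.sum_le_sum fun f _ => ?_
    rw [Finset.mul_sum]
    refine Finset.sum_le_sum fun g _ => ?_
    by_cases hfg : f = g
    · subst hfg; simp
    · rw [if_neg hfg]
      have hι0 : 0 ≤ ι (Dsc (m f g)) (G f) (G g) := by
        show 0 ≤ (Per (Dsc (m f g)) (G f) + Per (Dsc (m f g)) (G g) - Per (Dsc (m f g)) (G f ∪ G g)) / 2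
        have hDc : IsCompact (Dsc (m f g)) :=
          Metric.isCompact_of_isClosed_isBounded
            ((isClosed_le continuous_norm continuous_const).inter
              (isClosed_eq (continuous_id.inner continuous_const) continuous_const))
            (Metric.isBounded_closedBall.subset (cruxDisc_subset_closedBall (m f g)))
        have h := iota_nonneg_of_poly G (fun f => by
            rw [hGs]; exact ⟨(s f).card, fun i => Hc ((s f).equivFin.symm i), by
              ext x; simp only [mem_iUnion, exists_prop]
              constructor
              · rintro ⟨j, hj, hx⟩; exact ⟨(s f).equivFin ⟨j, hj⟩, by simpa using hx⟩
              · rintro ⟨i, hx⟩; exact ⟨_, ((s f).equivFin.symm i).2, hx⟩⟩)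
          hvol hdisjG hDc (convex_cruxDisc (m f g)) (zero_mem_cruxDisc (m f g)) hfg
        exact div_nonneg h (by norm_num)
      by_cases hτfg : τ f = τ g
      · rw [if_pos hτfg, mul_zero]
        exact mul_nonneg (div_nonneg (hc0 f g hfg) (by norm_num)) hι0
      · rw [if_neg hτfg]
        have hmfg : m f g = m₀ := hmax f g hfg hτfg
        have hc12 : 1 / 2 ≤ c f g := (htwin f g hfg ⟨m₀, hAx f g⟩ (hτ2 f g hτfg)).2
        have hιlow : ∑ a ∈ s f, ∑ b ∈ s g, Real.sqrt (1 - ⟪nv a b, m₀⟫_ℝ ^ 2) * fa a b ≤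
            ι (Dsc m₀) (G f) (G g) := by
          have h := sinSum_le_iota_of_polytopeCalculus hPC hm₀ Hc nv hbd hdisjQ hanti hplane
            (hsdisj f g hfg)
          have e1 : (⋃ j ∈ s f, polytope (Hc j)) = G f := (hGs f).symm
          have e2 : (⋃ j ∈ s g, polytope (Hc j)) = G g := (hGs g).symm
          have e3 : (⋃ j ∈ s f ∪ s g, polytope (Hc j)) = G f ∪ G g := by
            rw [Finset.set_biUnion_union, e1, e2]
          rw [e1, e2, e3] at h
          exact h
        rw [hmfg]
        have hZfg0 : 0 ≤ ∑ a ∈ s f, ∑ b ∈ s g, Real.sqrt (1 - ⟪nv a b, m₀⟫_ℝ ^ 2) * fa a b :=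
          Finset.sum_nonneg fun a _ => Finset.sum_nonneg fun b _ =>
            mul_nonneg (Real.sqrt_nonneg _) (hfa0 a b)
        rw [hmfg] at hι0
        nlinarith [hιlow, hc12, hι0, hZfg0]
  -- (v) assemble
  show 6 * (2 : ℝ) ^ ((1 : ℝ) / 3) * (Real.sqrt 2 * (volume (⋃ f, G f)).toReal) ^ ((2 : ℝ) / 3) ≤
    ∑ f, Per (W (A f)) (G f) - ∑ f, ∑ g, (if f = g then 0 else ι (W (A f)) (G f) (G g)) +
      ∑ f, ∑ g, (if f = g then 0 else c f g / 2 * ι (Dsc (m f g)) (G f) (G g))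
  have hR' : 6 * (2 : ℝ) ^ ((1 : ℝ) / 3) * (Real.sqrt 2 * (volume (⋃ f, G f)).toReal) ^ ((2 : ℝ) / 3) ≤
      (∑ f, Per (W (A f)) (G f) - ∑ f, ∑ g, (if f = g then 0 else ι (W (A f)) (G f) (G g))) +
        1 / Real.sqrt 6 * ∑ j, ∑ j', (if τ (gr j) = τ (gr j') then 0 else t j j') := by
    refine le_trans (le_of_eq ?_) (le_trans hR (le_of_eq ?_))
    · show _ = 6 * (2 : ℝ) ^ ((1 : ℝ) / 3) *
        (Real.sqrt 2 * (volume (⋃ j, ⋂ p ∈ Hc j, {x : E3 | ⟪p.1, x⟫_ℝ < p.2})).toReal) ^ ((2 : ℝ) / 3)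
      rw [hUnion]
    · show (∑ j, Per (W (A (gr j))) (⋂ p ∈ Hc j, {x : E3 | ⟪p.1, x⟫_ℝ < p.2}) -
          ∑ j, ∑ j', (if j = j' then 0 else ι (W (A (gr j))) (⋂ p ∈ Hc j, {x : E3 | ⟪p.1, x⟫_ℝ < p.2})
            (⋂ p ∈ Hc j', {x : E3 | ⟪p.1, x⟫_ℝ < p.2}))) +
          1 / Real.sqrt 6 * ∑ j, ∑ j', (if τ (gr j) = τ (gr j') then 0 else t j j') = _
      rw [hFr]
  rw [hregroup] at hR'
  have h6 : (0 : ℝ) < Real.sqrt 6 := Real.sqrt_pos.2 (by norm_num)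
  have hY : 1 / Real.sqrt 6 * ∑ f, ∑ g, (if τ f = τ g then 0 else ∑ a ∈ s f, ∑ b ∈ s g, t a b) ≤
      (1 : ℝ) / 4 * Z := by
    have e : 1 / Real.sqrt 6 * ∑ f, ∑ g, (if τ f = τ g then 0 else ∑ a ∈ s f, ∑ b ∈ s g, t a b) =
        (1 / 2) * (2 / Real.sqrt 6 * ∑ f, ∑ g, (if τ f = τ g then 0 else ∑ a ∈ s f, ∑ b ∈ s g, t a b)) := by
      ring
    rw [e]
    linarith only [hAz]
  linarith only [hR', hY, hwall]

end Summit.Ventures.Crystal3D.Cruxes.PolycrystalWulffBound.PolyDensity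

end
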